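import Summits.Ventures.CertifiedManyBodySolver.Upper.StripCellHamiltonian

/-!
# A canonical enumeration of the strip-cell configurations (`κ₀`, little-endian base 4, column-major in-cell index)

HONEST FRAMING: first certified bounds; not a superconductivity verdict; every number certified or labelled float.

The strip-cell presentation (`Upper/StripCellHamiltonian.lean`) and the consumers
(`Theorems/R2cStripCellConsumer*.lean`) are stated for ANY enumeration `κ : TensorIndex (Fin c ×ₗ Fin W) 4 ≃ Fin Q` of
the cell configurations. A certificate FILE must fix one; this file offers the canonical choice so that claim-node files
need not define their own:

* `cellSiteIndex c W : (Fin c ×ₗ Fin W) ≃ Fin (c * W)` — the column-major in-cell site index `r = y + W·j` of the site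
  `(j, y)` (column `j`, row `y`) — eng-1 `FORMAT-bdstrip-cell-v1`'s `y = x·W + yy`;
* `stripCellEnum c W : TensorIndex (Fin c ×ₗ Fin W) 4 ≃ Fin (4 ^ (c * W))` — `S = Σ_r k(site r) · 4^r`
  (`finFunctionFinEquiv`, LITTLE-endian: site `r = 0` is the least significant base-4 digit), with the tree's local index
  `k = 0 ↦ ∅, 1 ↦ ↑, 2 ↦ ↓, 3 ↦ ↑↓` (`siteOcc`); a file storing `s = 2n↑ + n↓` per site swaps `1 ↔ 2` digitwise, and a
  big-endian file reverses the digits — both on the producer side, exactly as for the chain formats (`FORMAT-umps1`);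
* `cellSiteIndex_apply_val`, `stripCellEnum_apply_val` — the two defining formulas, for the verifier writers.
-/

noncomputable section

namespace Summit.Ventures.CertifiedManyBodySolver.Upper

open Literature.MathematicalPhysics.QuantumLattice

/-- The column-major in-cell site index `(j, y) ↦ y + W·j` of a `c × W` cell. -/
def cellSiteIndex (c W : ℕ) : (Fin c ×ₗ Fin W) ≃ Fin (c * W) :=
  ofLex.trans finProdFinEquiv

/-- `cellSiteIndex c W (j, y) = y + W·j`. -/
theorem cellSiteIndex_apply_val (c W : ℕ) (f : Fin c ×ₗ Fin W) :
    ((cellSiteIndex c W f) : ℕ) = ((ofLex f).2 : ℕ) + W * ((ofLex f).1 : ℕ) := by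
  simp [cellSiteIndex]

/-- **The canonical cell enumeration** `κ₀`: a configuration `k` of the `c × W` cell ↦ `Σ_r k(site r) · 4^r` with the
column-major in-cell site index `r` (little-endian base-4 digits). -/
def stripCellEnum (c W : ℕ) : TensorIndex (Fin c ×ₗ Fin W) 4 ≃ Fin (4 ^ (c * W)) :=
  (Equiv.arrowCongr (cellSiteIndex c W) (Equiv.refl (Fin 4))).trans finFunctionFinEquiv

/-- `stripCellEnum c W k = Σ_r k(site r) · 4^r`, the sum over the in-cell site indices `r < c·W`. -/
theorem stripCellEnum_apply_val (c W : ℕ) (k : TensorIndex (Fin c ×ₗ Fin W) 4) :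
    ((stripCellEnum c W k) : ℕ) = ∑ r : Fin (c * W), ((k ((cellSiteIndex c W).symm r)) : ℕ) * 4 ^ (r : ℕ) := by
  simp [stripCellEnum, Equiv.arrowCongr_apply]

/-- The digit of `stripCellEnum c W k` at the site `f` is `k f`: `κ₀⁻¹ S` evaluated at `f` is the base-4 digit of `S` at
position `cellSiteIndex f`. -/
theorem stripCellEnum_symm_apply (c W : ℕ) (S : Fin (4 ^ (c * W))) (f : Fin c ×ₗ Fin W) :
    (stripCellEnum c W).symm S f = finFunctionFinEquiv.symm S (cellSiteIndex c W f) := by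
  simp [stripCellEnum, Equiv.arrowCongr_symm, Equiv.arrowCongr_apply]

end Summit.Ventures.CertifiedManyBodySolver.Upper

end
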